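import Literature.AlgebraicGeometry.ModuliOfAbelianVarieties.SiegelFramedCovariant
import Literature.AlgebraicGeometry.AbelianSchemes.PolarizedLevelPushforwardDetClass
import Literature.AlgebraicGeometry.Modules.SerreTwistHyperplaneClass
import HarnessLib

/-!
# Two linearly rigidified covariants of the same type are isomorphic, and the Plücker clause `PL` transports along the
# isomorphism — the uniqueness bridge (T2) ⇒ (T1) of the F-13 road ([MumfordFogartyKirwan1994] Prop. 7.6: «`H` represents
# the functor of linearly rigidified triples», hence is unique up to a unique isomorphism)

Topic `AlgebraicGeometry/ModuliOfAbelianVarieties`; namespace `Literature.AlgebraicGeometry.ModuliOfAbelianVarieties.SiegelFramedCovariant`.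
Cell hodgecm-mathlib (D-0151), F-DAG leaf F-13 «the Plücker class of the linearly rigidified covariant» = the PRODUCER of the
Plücker letter ★ `SiegelFramedCovariant.PL` consumed by the cores file F-12 (binder `hPL` of
★ `exists_threshold_siegelFineModuliScheme_of_cores'`) and by ★ `SiegelFineModuliScheme.isQuasiProjectiveOver_of_charts_of_PL`;
piece P0 of the census `B-provers/B-p10/g13/CENSUS-F13-PluckerPL.B-p10g13.md` (director s283).  Theorems only; no `def`, no
instance, no notation, no named fact, no `sorry`.  HC_CM is proved only modulo the 7 printed citations until rung 0 closes; nothing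
here is about HC.

## The source, as printed

[MumfordFogartyKirwan1994] Ch. 7 §2, Proposition 7.6 (p. 136): «the functor `𝓗_{g,d,n}` [polarised abelian schemes with level
structure plus a linear rigidification] is represented by the scheme `H_{g,d,n}`».  A representing object is unique up to a unique
isomorphism compatible with the universal objects (Yoneda); Proposition 7.4 (p. 135) — «`H_{g,d,n}` is quasi-projective and carries
a `PGL(m+1)`-linearized ample invertible sheaf» — is a statement about THE covariant, so in the tree, where ★ `SiegelFramedCovariant`
is an INTERFACE any producer may inhabit, it must be transported from one inhabitant to every other.

## What is here

* §1 **`exists_hom_isBaseChangeVia`** — between any two covariants `𝓗₁ 𝓗₂ : SiegelFramedCovariant g N δ J` there is a morphism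
  `f : 𝓗₁.H ⟶ 𝓗₂.H` over `ℚ` classifying `(𝓗₁.univ, 𝓗₁.emb)` (the field `represents` of `𝓗₂` applied to the universal datum
  of `𝓗₁`); **`eq_id_of_isBaseChangeVia`** — an endomorphism of `𝓗.H` classifying `𝓗`'s own universal datum is the identity
  (uniqueness in `represents` against ★ `PolarizedAbelianSchemeWithLevel.IsBaseChangeVia.refl`).
* §2 **`exists_iso_isBaseChangeVia`** — the two classifying morphisms are mutually inverse (★ `IsBaseChangeVia.trans` + §1): an
  isomorphism `e : 𝓗₁.H ≅ 𝓗₂.H` over `ℚ` with pull-back data `(G, Ĝ)` along `e.hom` and `(G', Ĝ')` along `e.inv`, `G ≫ emb₂ = emb₁`,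
  `G' ≫ emb₁ = emb₂`.
* §3 **`pl_of_pl`** — the Plücker clause transports: `𝓗₂.PL → 𝓗₁.PL` (compactness and the immersion `ι_H` move along the
  isomorphism of schemes; the class identity moves by ★ `SerreTwist.detClass_serreTwist_comp` on the left and the functoriality of
  the Plücker partner ★ `PolarizedAbelianSchemeWithLevel.detClass_plucker_partner_of_isBaseChangeVia` on the right); and the
  combinator **`pl_of_exists_pl`**: `PL` of ONE covariant gives `PL` of EVERY covariant of the same type — so the F-12 letter
  `hPL : ∀ 𝓗, LocallyOfFiniteType 𝓗.H.hom → 𝓗.PL` follows from the Plücker class of any single produced covariant.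

## References
* [MumfordFogartyKirwan1994] D. Mumford, J. Fogarty, F. Kirwan, *Geometric Invariant Theory*, 3rd ed. (1994), Ch. 7 §2 Prop. 7.6
  (p. 136), Prop. 7.4 (p. 135), Def. 7.2 (p. 129).
-/

noncomputable section

open CategoryTheory CategoryTheory.Limits AlgebraicGeometry TopologicalSpace

namespace Literature.AlgebraicGeometry.ModuliOfAbelianVarieties

namespace SiegelFramedCovariant

open Literature.AlgebraicGeometry.AbelianSchemes Literature.AlgebraicGeometry.Modules
open Literature.AlgebraicGeometry.Morphisms.ProjCech (PP toSpec)

variable {g N : ℕ} {δ : Fin g → ℕ} {J : Type} (𝓗₁ 𝓗₂ : SiegelFramedCovariant g N δ J)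

/-! ## §1 The classifying morphism between two covariants -/

/-- **Between two covariants of the same type there is a classifying morphism**: `𝓗₂` represents linearly rigidified triples
([MumfordFogartyKirwan1994] Prop. 7.6), and `(𝓗₁.univ, 𝓗₁.emb)` is one over the locally Noetherian `ℚ`-scheme `𝓗₁.H` — so it is
the pull-back of `(𝓗₂.univ, 𝓗₂.emb)` along some `f : 𝓗₁.H ⟶ 𝓗₂.H`. [cite: MumfordFogartyKirwan1994, Ch. 7 §2 Proposition 7.6 (p. 136)] -/
theorem exists_hom_isBaseChangeVia :
    ∃ (f : 𝓗₁.H ⟶ 𝓗₂.H) (G : 𝓗₁.univ.A.X.left ⟶ 𝓗₂.univ.A.X.left)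
      (Ĝ : 𝓗₁.univ.D.hat.X.left ⟶ 𝓗₂.univ.D.hat.X.left),
      𝓗₁.univ.IsBaseChangeVia 𝓗₂.univ f.left G Ĝ ∧ G ≫ 𝓗₂.emb = 𝓗₁.emb := by
  haveI := 𝓗₁.isLocallyNoetherian
  obtain ⟨f, ⟨G, Ĝ, h, hG⟩, -⟩ := 𝓗₂.represents 𝓗₁.H 𝓗₁.univ 𝓗₁.emb 𝓗₁.isLinearRigidification_emb
  exact ⟨f, G, Ĝ, h, hG⟩

/-- **An endomorphism of `H` classifying the universal datum is the identity** (uniqueness in [MumfordFogartyKirwan1994] Prop. 7.6: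
the identity classifies `(univ, emb)` via ★ `IsBaseChangeVia.refl`). [cite: MumfordFogartyKirwan1994, Ch. 7 §2 Proposition 7.6 (p. 136)] -/
theorem eq_id_of_isBaseChangeVia (𝓗 : SiegelFramedCovariant g N δ J) {f : 𝓗.H ⟶ 𝓗.H}
    {G : 𝓗.univ.A.X.left ⟶ 𝓗.univ.A.X.left} {Ĝ : 𝓗.univ.D.hat.X.left ⟶ 𝓗.univ.D.hat.X.left}
    (h : 𝓗.univ.IsBaseChangeVia 𝓗.univ f.left G Ĝ) (hG : G ≫ 𝓗.emb = 𝓗.emb) : f = 𝟙 𝓗.H := by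
  haveI := 𝓗.isLocallyNoetherian
  exact 𝓗.classifying_unique 𝓗.H 𝓗.univ 𝓗.emb 𝓗.isLinearRigidification_emb h hG
    (PolarizedAbelianSchemeWithLevel.IsBaseChangeVia.refl 𝓗.univ) (Category.id_comp _)

/-! ## §2 Any two covariants are isomorphic over `ℚ`, compatibly with the universal data -/

/-- **Two linearly rigidified covariants of the same type `(g, N, δ, J)` are isomorphic over `ℚ`**, by an isomorphism
`e : 𝓗₁.H ≅ 𝓗₂.H` along whose two directions the universal triples are pull-backs of each other with the universal embeddings
matching ([MumfordFogartyKirwan1994] Prop. 7.6: a representing object is unique up to unique isomorphism — the two classifying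
morphisms compose to endomorphisms classifying the universal data, hence to identities).
[cite: MumfordFogartyKirwan1994, Ch. 7 §2 Proposition 7.6 (p. 136)] -/
theorem exists_iso_isBaseChangeVia :
    ∃ (e : 𝓗₁.H ≅ 𝓗₂.H) (G : 𝓗₁.univ.A.X.left ⟶ 𝓗₂.univ.A.X.left)
      (Ĝ : 𝓗₁.univ.D.hat.X.left ⟶ 𝓗₂.univ.D.hat.X.left) (G' : 𝓗₂.univ.A.X.left ⟶ 𝓗₁.univ.A.X.left)
      (Ĝ' : 𝓗₂.univ.D.hat.X.left ⟶ 𝓗₁.univ.D.hat.X.left),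
      𝓗₁.univ.IsBaseChangeVia 𝓗₂.univ e.hom.left G Ĝ ∧ G ≫ 𝓗₂.emb = 𝓗₁.emb ∧
        𝓗₂.univ.IsBaseChangeVia 𝓗₁.univ e.inv.left G' Ĝ' ∧ G' ≫ 𝓗₁.emb = 𝓗₂.emb := by
  obtain ⟨f, G, Ĝ, h, hG⟩ := exists_hom_isBaseChangeVia 𝓗₁ 𝓗₂
  obtain ⟨f', G', Ĝ', h', hG'⟩ := exists_hom_isBaseChangeVia 𝓗₂ 𝓗₁
  have h₁ : f ≫ f' = 𝟙 _ :=
    eq_id_of_isBaseChangeVia 𝓗₁ (f := f ≫ f') (h.trans h') (by rw [Category.assoc, hG', hG])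
  have h₂ : f' ≫ f = 𝟙 _ :=
    eq_id_of_isBaseChangeVia 𝓗₂ (f := f' ≫ f) (h'.trans h) (by rw [Category.assoc, hG, hG'])
  exact ⟨⟨f, f', h₁, h₂⟩, G, Ĝ, G', Ĝ', h, hG, h', hG'⟩

/-! ## §3 The Plücker clause transports along the isomorphism -/

/-- **The Plücker clause of one covariant gives that of any other of the same type** ([MumfordFogartyKirwan1994] Prop. 7.4 is
about THE scheme `H_{g,d,n}`; here it moves between inhabitants of the interface): along the isomorphism `e : 𝓗₁.H ≅ 𝓗₂.H` of
§2, `𝓗₁.H` is quasi-compact, `e.hom ≫ ι_{H₂}` is an immersion over the structure map, the graph datum of `𝓗₁.univ` is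
`(1, λ₁)`, and the class identity pulls back: `[𝒪(−m)]` along `e.hom` by ★ `SerreTwist.detClass_serreTwist_comp`, the Plücker
partner by ★ `PolarizedAbelianSchemeWithLevel.detClass_plucker_partner_of_isBaseChangeVia` (same exponents).
[cite: MumfordFogartyKirwan1994, Ch. 7 §2 Proposition 7.4 (p. 135)] [cite: MumfordFogartyKirwan1994, Ch. 7 §2 Proposition 7.6 (p. 136)] -/
theorem pl_of_pl (h₂ : 𝓗₂.PL) : 𝓗₁.PL := by
  haveI := 𝓗₁.isLocallyNoetherian
  haveI := 𝓗₂.isLocallyNoetherian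
  obtain ⟨e, G, Ĝ, -, -, h, hG, -, -⟩ := exists_iso_isBaseChangeVia 𝓗₁ 𝓗₂
  obtain ⟨hc₂, r, ιH, hιH, hιq, Gr, hGr₁, hGr₂, m, hm, s, k, hk, a, c, heq⟩ := h₂
  -- `𝓗₁.H` is quasi-compact: homeomorphic to `𝓗₂.H`
  haveI : IsIso e.hom.left := inferInstance
  haveI hc₁ : CompactSpace 𝓗₁.H.left := (Scheme.homeoOfIso (asIso e.hom.left)).symm.compactSpace
  -- the graph datum `(1, λ₁)` of the universal triple of `𝓗₁`
  let Gr₁ : 𝓗₁.univ.A.X.left ⟶ 𝓗₁.univ.A.prodLeft 𝓗₁.univ.D.hat :=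
    pullback.lift (𝟙 _) 𝓗₁.univ.pol.lam.left (by rw [Category.id_comp, Over.w])
  have hGr₁₁ : Gr₁ ≫ pullback.fst 𝓗₁.univ.A.X.hom 𝓗₁.univ.D.hat.X.hom = 𝟙 _ := pullback.lift_fst _ _ _
  have hGr₁₂ : Gr₁ ≫ pullback.snd 𝓗₁.univ.A.X.hom 𝓗₁.univ.D.hat.X.hom = 𝓗₁.univ.pol.lam.left := pullback.lift_snd _ _ _
  refine ⟨hc₁, r, e.hom.left ≫ ιH, inferInstance, ?_, Gr₁, hGr₁₁, hGr₁₂, m, hm, s, k, hk, a, c, ?_⟩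
  · rw [Category.assoc, hιq, Over.w]
  · rw [SerreTwist.detClass_serreTwist_comp, heq]
    exact (PolarizedAbelianSchemeWithLevel.detClass_plucker_partner_of_isBaseChangeVia 𝓗₂.H.hom h Gr hGr₁ hGr₂
      Gr₁ hGr₁₁ hGr₁₂ hk a c).symm

/-- **`PL` of ONE covariant gives `PL` of EVERY covariant of the same type** — the (T2) ⇒ (T1) combinator of the F-13 road: the
F-12 letter `hPL : ∀ 𝓗, LocallyOfFiniteType 𝓗.H.hom → 𝓗.PL` follows (with the finite-type premise unused) from the Plücker class
of any single produced covariant ([MumfordFogartyKirwan1994] Prop. 7.4 for `H_{g,d,n}` + Prop. 7.6 uniqueness).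
[cite: MumfordFogartyKirwan1994, Ch. 7 §2 Proposition 7.4 (p. 135)] [cite: MumfordFogartyKirwan1994, Ch. 7 §2 Proposition 7.6 (p. 136)] -/
theorem pl_of_exists_pl (h : ∃ 𝓗₀ : SiegelFramedCovariant g N δ J, 𝓗₀.PL) (𝓗 : SiegelFramedCovariant g N δ J) : 𝓗.PL := by
  obtain ⟨𝓗₀, h₀⟩ := h
  exact pl_of_pl 𝓗 𝓗₀ h₀

end SiegelFramedCovariant

end Literature.AlgebraicGeometry.ModuliOfAbelianVarieties

end
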